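import Summits.AnomalousDissipation.AnomalousDissipation.Theorems.SawtoothPulseCascadeK1LocalisedCascadeLedgerClassChain

/-!
# K1loc, line `Spectral` / thin start — helper: THE CLASS CHAIN IN ENERGY FORM (junk energies add) and its closer

Helper file of the prover lane on the crux `K1LocalisedCascade` (stmt-AnomalousDissipation-19491), route `SawtoothPulseCascade`
(S-B/S-C assembly seat; the LEDGER ASSEMBLY, abstract layer — companion of `…LedgerClassChain`).  `…LedgerClassChain` turns the three
tracked-pair steps (S-V) `S' ≤ T + (w^S + √P¹)² + f^S`, (T-H) `T ≤ S + (w^T + √O)² + f^T`, (O-V) `O' ≤ (w^O + √P²)² + f^O` into the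
AMPLITUDE ledger `√E' ≤ √E + η`; `K1Window.strip_step` (`…LedgerChain`, ad-sawtooth-k1loc-p1) observed that the ENERGY form is
additive: the `O` inside the pass-through square `(w^T + √O)²` cancels against the tracked `O`, so
`E' ≤ E + (w^T² + 2w^T√O + (w^S + √P¹)² + (w^O + √P²)² + f^S + f^T + f^O)` — an increment QUADRATIC in the junk amplitudes, whose
sum over windows and phases is far smaller than the square of the summed amplitudes.  This file records that step for the
tracked pair `E = S + O` (the (T-H) feed being the off-cone class `O`, not the shell class `A(0)` of `strip_step`) and the closers
**`k1Localised_of_class_energy_ledger`** / **`_geometric`** = `k1Localised_of_energy_ledger` ∘ (integer-form channel domination of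
`…LedgerClassChain`), budget `S_{j₀} + O_{j₀} + Σ'e < ‖datum‖²` (resp. `+ C_e/(1−θ)`).  No definitions; nothing about `δ₀ = ¼`.
[cite: DEIJ2022, (1.2)–(1.3)] [cite: ElgindiLissMattingly2025, §1.2.2 and §3.1] [cite: Grafakos2014, Prop. 3.2.7 (3)] [problem: turb]
-/

-- `Summit.<Summit>.<Problem>`: single-conjunct summit, the duplicate namespace segment is deliberate.
set_option linter.dupNamespace false

noncomputable section

namespace Summit.AnomalousDissipation.AnomalousDissipation.Theorems.SawtoothPulseCascade.K1Ledger.From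

open MeasureTheory Set Filter Topology UnitAddTorus Function
open scoped ENNReal
open Literature.Analysis Literature.Analysis.FunctionSpaces Literature.Analysis.FunctionSpaces.Torus Literature.Analysis.FluidPDE
open Literature.Analysis.FluidPDE.ShearStage
open Literature.Analysis.FluidPDE.SawtoothCascade Literature.Analysis.FluidPDE.SawtoothCascade.CascadeParams
open Summit.AnomalousDissipation.AnomalousDissipation.Theorems.SawtoothPulseCascade.K1Window

/-! ## §1 The tracked-pair step in energy form -/

/-- **THE TRACKED-PAIR STEP, ENERGY FORM** (the shape of `K1Window.strip_step` with the (T-H) feed generalised from the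
shell class `A_j(0)` to the off-cone class `O_j`): (S-V) + (T-H) + (O-V) at one phase give
`S' + O' ≤ (S + O) + (w^T² + 2w^T√O + (w^S + √P¹)² + (w^O + √P²)² + f^S + f^T + f^O)` — the `O` of the pass-through square
`(w^T + √O)²` cancels against the tracked `O`, so the increment is QUADRATIC in the junk amplitudes. [folklore] -/
theorem strip_offCone_energy_step {S T O S' O' P₁ P₂ wS wT wO fS fT fO : ℝ}
    (h1 : S' ≤ T + (wS + Real.sqrt P₁) ^ 2 + fS) (h2 : T ≤ S + (wT + Real.sqrt O) ^ 2 + fT)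
    (h3 : O' ≤ (wO + Real.sqrt P₂) ^ 2 + fO) (hO : 0 ≤ O) :
    S' + O' ≤ S + O +
      (wT ^ 2 + 2 * wT * Real.sqrt O + (wS + Real.sqrt P₁) ^ 2 + (wO + Real.sqrt P₂) ^ 2 + fS + fT + fO) := by
  have e : (wT + Real.sqrt O) ^ 2 = wT ^ 2 + 2 * wT * Real.sqrt O + O := by rw [add_sq, Real.sq_sqrt hO]
  linarith

/-- **The energy ledger along the phases**: `E_{j+1} ≤ E_j + e_j` for `E_j = S_j + O_j` with the explicit junk ENERGY
`e_j = w^T_j² + 2w^T_j√O_j + (w^S_j + √P¹_j)² + (w^O_j + √P²_j)² + f^S_j + f^T_j + f^O_j` — the `hstep` hypothesis of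
`k1Localised_of_energy_ledger`. [folklore] -/
theorem strip_offCone_energy_ledger {S T O P₁ P₂ wS wT wO fS fT fO : ℕ → ℝ} {j₀ : ℕ}
    (h1 : ∀ j, j₀ ≤ j → S (j + 1) ≤ T j + (wS j + Real.sqrt (P₁ j)) ^ 2 + fS j)
    (h2 : ∀ j, j₀ ≤ j → T j ≤ S j + (wT j + Real.sqrt (O j)) ^ 2 + fT j)
    (h3 : ∀ j, j₀ ≤ j → O (j + 1) ≤ (wO j + Real.sqrt (P₂ j)) ^ 2 + fO j) (hO : ∀ j, 0 ≤ O j) :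
    ∀ j, j₀ ≤ j → S (j + 1) + O (j + 1) ≤ S j + O j +
      (wT j ^ 2 + 2 * wT j * Real.sqrt (O j) + (wS j + Real.sqrt (P₁ j)) ^ 2 + (wO j + Real.sqrt (P₂ j)) ^ 2 +
        fS j + fT j + fO j) :=
  fun j hj => strip_offCone_energy_step (h1 j hj) (h2 j hj) (h3 j hj) (hO j)

/-! ## §2 The closers -/

section Cascade

variable (P : CascadeParams)

/-- **`K1Localised P (γ² − 3)` from the CLASS LEDGER, ENERGY FORM** (shape P, `L_min ≥ 1000`): the data of
`k1Localised_of_class_ledger` with the junk hypotheses replaced by: `w^T, f ≥ 0`, the junk energies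
`e_j = w^T_j² + 2w^T_j√O_j + (w^S_j + √P¹_j)² + (w^O_j + √P²_j)² + f^S_j + f^T_j + f^O_j` summable, and the budget
`(S_{j₀} + O_{j₀}) + Σ'_i e_{j₀+i} < ‖datum‖²`.  Then `K1Localised P (γ² − 3)`, by `k1Localised_of_energy_ledger` with
`T = S + O`.  (Sharper than the amplitude form whenever the junk is spread over many windows: energies add.)
[cite: DEIJ2022, (1.2)–(1.3)] [cite: ElgindiLissMattingly2025, §1.2.2 and §3.1] [cite: Grafakos2014, Prop. 3.2.7 (3)] -/
theorem k1Localised_of_class_energy_ledger (hγ : 5 ≤ P.γ) (hγ' : P.γ ≤ 8) (hδ₀ : 0 < P.δ₀)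
    (hδ₀' : P.δ₀ ≤ 1 / 4) (hd : P.d = 2) (hN₀ : P.N₀ = 1) (hρN : P.ρN = 2) {Lm : ℝ} (hLm : 1000 ≤ Lm)
    (a b : ℕ → UnitAddTorus (Fin 2) → ℝ) (has : ∀ j, IsSmooth (a j)) (h0 : a 0 = datum)
    (hb : ∀ j, b j = a j ∘ shearMap 0 1 (amp ⟨P.U j, P.U_periodic j, P.contDiff_U (P.δ_pos hδ₀ (by rw [hd]; norm_num) j)⟩ P.γ))
    (hab : ∀ j, a (j + 1) = b j ∘ shearMap 1 0 (amp ⟨P.U j, P.U_periodic j, P.contDiff_U (P.δ_pos hδ₀ (by rw [hd]; norm_num) j)⟩ P.γ))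
    (K : ℕ → ℕ) {c : ℝ} (hc : 0 < c) {u v : ℕ} (huv : (u : ℝ) * P.γ ≤ 13 / 10 * v)
    (S T O P₁ P₂ wS wT wO fS fT fO : ℕ → ℝ) {j₁ j₀ : ℕ}
    (hcK : ∀ n, j₁ ≤ n → (1 + 1 / 250) * (c * (P.γ ^ 2 - 3) ^ n) ≤ K n)
    (hSn : ∀ n, j₁ ≤ n → ∑' k : Fin 2 → ℤ, (if |k 0| < (K n : ℤ) then (1 : ℝ) else 0) *
        ‖mFourierCoeff (fun x => (a n x : ℂ)) k‖ ^ 2 ≤ S n)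
    (hOn : ∀ n, j₁ ≤ n → ∑' k : Fin 2 → ℤ, (if (K n : ℤ) ≤ |k 0| ∧ (u : ℤ) * |k 0| ≤ (v : ℤ) * |k 1| then (1 : ℝ) else 0) *
        ‖mFourierCoeff (fun x => (a n x : ℂ)) k‖ ^ 2 ≤ O n)
    (h1 : ∀ j, j₀ ≤ j → S (j + 1) ≤ T j + (wS j + Real.sqrt (P₁ j)) ^ 2 + fS j)
    (h2 : ∀ j, j₀ ≤ j → T j ≤ S j + (wT j + Real.sqrt (O j)) ^ 2 + fT j)
    (h3 : ∀ j, j₀ ≤ j → O (j + 1) ≤ (wO j + Real.sqrt (P₂ j)) ^ 2 + fO j)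
    (hO : ∀ j, 0 ≤ O j) (hwT : ∀ j, 0 ≤ wT j)
    (hfS : ∀ j, 0 ≤ fS j) (hfT : ∀ j, 0 ≤ fT j) (hfO : ∀ j, 0 ≤ fO j)
    (hes : Summable fun j => wT j ^ 2 + 2 * wT j * Real.sqrt (O j) + (wS j + Real.sqrt (P₁ j)) ^ 2 +
        (wO j + Real.sqrt (P₂ j)) ^ 2 + fS j + fT j + fO j)
    (hbudget : S j₀ + O j₀ + ∑' i, (wT (j₀ + i) ^ 2 + 2 * wT (j₀ + i) * Real.sqrt (O (j₀ + i)) +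
        (wS (j₀ + i) + Real.sqrt (P₁ (j₀ + i))) ^ 2 + (wO (j₀ + i) + Real.sqrt (P₂ (j₀ + i))) ^ 2 +
        fS (j₀ + i) + fT (j₀ + i) + fO (j₀ + i)) < Torus.scalarL2Sq datum) :
    K1Localised P (P.γ ^ 2 - 3) := by
  have hγ0 : 0 < P.γ := by linarith
  refine k1Localised_of_energy_ledger P hγ hγ' hδ₀ hδ₀' hd hN₀ hρN hLm a b has h0 hb hab hc (fun n => S n + O n)
    (fun j => wT j ^ 2 + 2 * wT j * Real.sqrt (O j) + (wS j + Real.sqrt (P₁ j)) ^ 2 + (wO j + Real.sqrt (P₂ j)) ^ 2 +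
      fS j + fT j + fO j)
    (i₁ := j₁) (j₀ := j₀) (fun n hn => ?_) (strip_offCone_energy_ledger h1 h2 h3 hO)
    (fun j => by
      have h2' : 0 ≤ 2 * wT j * Real.sqrt (O j) := by
        have := hwT j; have := Real.sqrt_nonneg (O j); positivity
      linarith [sq_nonneg (wT j), sq_nonneg (wS j + Real.sqrt (P₁ j)), sq_nonneg (wO j + Real.sqrt (P₂ j)),
        hfS j, hfT j, hfO j])
    hes hbudget
  -- domination of the two thin channels (as in `k1Localised_of_class_ledger`)
  set cf : (Fin 2 → ℤ) → ℝ := fun k => ‖mFourierCoeff (fun x => (a n x : ℂ)) k‖ ^ 2 with hcf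
  have hcs : Summable cf := (SpectralLeakage.hasSum_sq_norm_mFourierCoeff_scalarL2Sq (has n).continuous).summable
  have hc0 : ∀ k, 0 ≤ cf k := fun k => sq_nonneg _
  have hI : ∀ (p : (Fin 2 → ℤ) → Prop) [DecidablePred p], Summable fun k => (if p k then (1 : ℝ) else 0) * cf k := by
    intro p _
    refine Summable.of_nonneg_of_le (fun k => mul_nonneg (by split_ifs <;> norm_num) (hc0 k)) (fun k => ?_) hcs
    exact mul_le_of_le_one_left (hc0 k) (by split_ifs <;> norm_num)
  have hdom := tsum_lowBand_offCone_le hcs hc0 (fun k : Fin 2 → ℤ => ((k 0 : ℤ) : ℝ))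
    (fun k : Fin 2 → ℤ => 13 / 10 * |((k 0 : ℤ) : ℝ)| < P.γ * |((k 1 : ℤ) : ℝ)|) (hcK n hn)
  refine hdom.trans (add_le_add ?_ ?_)
  · refine le_of_eq_of_le (tsum_congr fun k => ?_) (hSn n hn)
    rw [indicator_abs_lt_natCast_eq]
  · refine le_trans ((hI _).tsum_le_tsum (fun k => ?_) (hI _)) (hOn n hn)
    exact mul_le_mul_of_nonneg_right (indicator_offCone_le_ratioClass hγ0 huv (K n) (k 0) (k 1)) (hc0 k)

/-- **The class ledger, energy form, with GEOMETRIC junk energies** (closed-form budget): if the junk energy of phase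
`j₀ + i` is at most `C_e·θⁱ` (`0 ≤ θ < 1`), the budget reads `S_{j₀} + O_{j₀} + C_e/(1−θ) < ‖datum‖²`.
[cite: DEIJ2022, (1.2)–(1.3)] [cite: ElgindiLissMattingly2025, §1.2.2 and §3.1] -/
theorem k1Localised_of_class_energy_ledger_geometric (hγ : 5 ≤ P.γ) (hγ' : P.γ ≤ 8) (hδ₀ : 0 < P.δ₀)
    (hδ₀' : P.δ₀ ≤ 1 / 4) (hd : P.d = 2) (hN₀ : P.N₀ = 1) (hρN : P.ρN = 2) {Lm : ℝ} (hLm : 1000 ≤ Lm)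
    (a b : ℕ → UnitAddTorus (Fin 2) → ℝ) (has : ∀ j, IsSmooth (a j)) (h0 : a 0 = datum)
    (hb : ∀ j, b j = a j ∘ shearMap 0 1 (amp ⟨P.U j, P.U_periodic j, P.contDiff_U (P.δ_pos hδ₀ (by rw [hd]; norm_num) j)⟩ P.γ))
    (hab : ∀ j, a (j + 1) = b j ∘ shearMap 1 0 (amp ⟨P.U j, P.U_periodic j, P.contDiff_U (P.δ_pos hδ₀ (by rw [hd]; norm_num) j)⟩ P.γ))
    (K : ℕ → ℕ) {c : ℝ} (hc : 0 < c) {u v : ℕ} (huv : (u : ℝ) * P.γ ≤ 13 / 10 * v)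
    (S T O P₁ P₂ wS wT wO fS fT fO : ℕ → ℝ) {j₁ j₀ : ℕ}
    (hcK : ∀ n, j₁ ≤ n → (1 + 1 / 250) * (c * (P.γ ^ 2 - 3) ^ n) ≤ K n)
    (hSn : ∀ n, j₁ ≤ n → ∑' k : Fin 2 → ℤ, (if |k 0| < (K n : ℤ) then (1 : ℝ) else 0) *
        ‖mFourierCoeff (fun x => (a n x : ℂ)) k‖ ^ 2 ≤ S n)
    (hOn : ∀ n, j₁ ≤ n → ∑' k : Fin 2 → ℤ, (if (K n : ℤ) ≤ |k 0| ∧ (u : ℤ) * |k 0| ≤ (v : ℤ) * |k 1| then (1 : ℝ) else 0) *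
        ‖mFourierCoeff (fun x => (a n x : ℂ)) k‖ ^ 2 ≤ O n)
    (h1 : ∀ j, j₀ ≤ j → S (j + 1) ≤ T j + (wS j + Real.sqrt (P₁ j)) ^ 2 + fS j)
    (h2 : ∀ j, j₀ ≤ j → T j ≤ S j + (wT j + Real.sqrt (O j)) ^ 2 + fT j)
    (h3 : ∀ j, j₀ ≤ j → O (j + 1) ≤ (wO j + Real.sqrt (P₂ j)) ^ 2 + fO j)
    (hO : ∀ j, 0 ≤ O j) (hwT : ∀ j, 0 ≤ wT j)
    (hfS : ∀ j, 0 ≤ fS j) (hfT : ∀ j, 0 ≤ fT j) (hfO : ∀ j, 0 ≤ fO j)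
    {Ce θ : ℝ} (hθ0 : 0 ≤ θ) (hθ1 : θ < 1)
    (heC : ∀ i, wT (j₀ + i) ^ 2 + 2 * wT (j₀ + i) * Real.sqrt (O (j₀ + i)) +
        (wS (j₀ + i) + Real.sqrt (P₁ (j₀ + i))) ^ 2 + (wO (j₀ + i) + Real.sqrt (P₂ (j₀ + i))) ^ 2 +
        fS (j₀ + i) + fT (j₀ + i) + fO (j₀ + i) ≤ Ce * θ ^ i)
    (hbudget : S j₀ + O j₀ + Ce / (1 - θ) < Torus.scalarL2Sq datum) :
    K1Localised P (P.γ ^ 2 - 3) := by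
  set e : ℕ → ℝ := fun j => wT j ^ 2 + 2 * wT j * Real.sqrt (O j) + (wS j + Real.sqrt (P₁ j)) ^ 2 +
    (wO j + Real.sqrt (P₂ j)) ^ 2 + fS j + fT j + fO j with he
  have he0 : ∀ j, 0 ≤ e j := fun j => by
    simp only [he]
    have h2' : 0 ≤ 2 * wT j * Real.sqrt (O j) := by
      have := hwT j; have := Real.sqrt_nonneg (O j); positivity
    linarith [sq_nonneg (wT j), sq_nonneg (wS j + Real.sqrt (P₁ j)), sq_nonneg (wO j + Real.sqrt (P₂ j)),
      hfS j, hfT j, hfO j]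
  have hgeo : Summable fun i : ℕ => Ce * θ ^ i := (summable_geometric_of_lt_one hθ0 hθ1).mul_left Ce
  have hshift : Summable fun i : ℕ => e (j₀ + i) := Summable.of_nonneg_of_le (fun i => he0 _) (fun i => heC i) hgeo
  have hes : Summable e := by
    rw [← summable_nat_add_iff j₀]
    simpa only [add_comm] using hshift
  have htail : ∑' i, e (j₀ + i) ≤ Ce / (1 - θ) := by
    calc ∑' i, e (j₀ + i) ≤ ∑' i : ℕ, Ce * θ ^ i := hshift.tsum_le_tsum (fun i => heC i) hgeo
      _ = Ce / (1 - θ) := by rw [tsum_mul_left, tsum_geometric_of_lt_one hθ0 hθ1, div_eq_mul_inv]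
  exact k1Localised_of_class_energy_ledger P hγ hγ' hδ₀ hδ₀' hd hN₀ hρN hLm a b has h0 hb hab K hc huv S T O P₁ P₂ wS wT wO
    fS fT fO hcK hSn hOn h1 h2 h3 hO hwT hfS hfT hfO hes (by linarith)

end Cascade

end Summit.AnomalousDissipation.AnomalousDissipation.Theorems.SawtoothPulseCascade.K1Ledger.From
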